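import Summits.QuantumAdvantage.QuantumAdvantage.Theorems.CubicForrelationNearExactIsExactTwelveWildParity

/-!
# Crux `CubicForrelation.NearExactIsExact` (stmt-QuantumAdvantage-14043) — n = 12, level 5 below the second boundary: tools
  (the cubic second digit, Ax over an affine hyperplane and its coordinate traces, Walsh inversion in integer form)

Certificate seat `b2b-cforr-cert` (gen 13).  HONEST FRAMING: lemmas (standard axioms) for `tw5_levelFive_window`
(`…TwelveLevelFiveWindow.lean`); finite-slice bookkeeping about cubic Boolean pairs on 12 bits, NOT summit progress.

Setting: cubic `g : 𝔽₂¹² → 𝔽₂` with `W_g = 32·u'` (type E) and `P = {u' odd}` the affine parity set (degree `≤ 1`, `stub_walshTower`).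
* `tw5_digit`: the digit `D = [⌊u'/2⌋ odd]` is CUBIC (cube sums `4 ∣ Σ_{C_I} u'` for `|I| ≥ 4` from `cube_sum_dvd`, `4 ∣ #(C_I ∩ P)` for
  `|I| ≥ 3` from Ax at degree 1, then Möbius `bb_moebius_isDegLeFun`);
* `tw5_axP`: for affine `ℓ` and cubic `D`, `16 ∣ Σ_{ℓ = 1} (−1)^D` and `16 ∣ Σ_{ℓ = 1, x_j = 0} (−1)^D` — the set `{ℓ = 1}` is the
  annihilator of the normal vector of `ℓ` (`stub_affineForm`) or its complement, and Ax on annihilators (`fs_ax_annihilator`) gives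
  `2^⌈11/3⌉ = 2^⌈10/3⌉ = 16`;
* `tw5_inversion`: `Σ_x u'(x) = 128(−1)^{g(0)}` and `Σ_x u'(x)(−1)^{x_j} = 128(−1)^{g(e_j)}` (Walsh inversion `tz_inversion`).

References: J. Ax (1964) / R. J. McEliece (1972); C. Carlet (2021) §2.2, §4.1; MacWilliams–Sloane (1977) Ch. 13–14.  Everything below is
proved from Mathlib and the tree; axioms are the standard three.
-/

set_option linter.dupNamespace false -- D-0017: single-problem summit ⇒ `QuantumAdvantage.QuantumAdvantage` by design

noncomputable section

namespace Summit.QuantumAdvantage.QuantumAdvantage.Theorems.CubicForrelation.NearExactIsExact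

open Finset
open Literature.Computability.QuantumComplexity
open Literature.Computability.QuantumComplexity.BuzetChailloux (bxor zeroVec bxor_bxor_cancel_left bxor_zeroVec zeroVec_bxor bxor_comm
  bxor_self twist_zeroVec_right)
open Literature.Computability.QuantumComplexity.Simon (twist_eq_one_or)
open Literature.Computability.QuantumComplexity.DerivativeWalsh (W)

/-! ### Level 5 on 12 bits: tools -/

section LevelFiveTools

open Summit.QuantumAdvantage.QuantumAdvantage.Theorems.NearExactIsExact.Negative (TypeOTwelve.cube_sum_dvd)

/-- **The second digit at level 5 is cubic.**  For cubic `g` on 12 bits with `W_g = 32u'` and affine parity `[u' odd]`, the digit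
`[⌊u'/2⌋ odd]` has degree `≤ 3` (cube sums: `4 ∣ Σ_{C_I} u'` for `|I| ≥ 4`, `4 ∣ #(C_I ∩ {u' odd})` for `|I| ≥ 3`, Möbius). [this work] -/
theorem tw5_digit (g : (Fin (6 + 6) → Bool) → Bool) (hg : IsDegLeFun 3 g) (u' : (Fin (6 + 6) → Bool) → ℤ)
    (hu' : ∀ x, W (fun y => signOf (g y)) x = (2 : ℝ) ^ 5 * (u' x : ℝ)) (hℓ : IsDegLeFun 1 (fun x => decide (Odd (u' x)))) :
    IsDegLeFun 3 (fun x => decide (Odd (u' x / 2))) := by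
  classical
  set u : (Fin (6 + 6) → Bool) → ℤ := fun x => 2 * u' x with hudef
  have hu : ∀ x, W (fun y => signOf (g y)) x = (2 : ℝ) ^ 4 * (u x : ℝ) := by
    intro x; rw [hu' x]; simp only [u]; push_cast; ring
  have hpt : ∀ x, u' x = (if decide (Odd (u' x)) = true then 1 else 0 : ℤ) + 2 * (if decide (Odd (u' x / 2)) = true then 1 else 0 : ℤ) +
      4 * (u' x / 2 / 2) := by
    have hind : ∀ m : ℤ, (if decide (Odd m) = true then (1 : ℤ) else 0) = m % 2 := by
      intro m
      rcases Int.emod_two_eq_zero_or_one m with h | h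
      · have hm : ¬ Odd m := by rw [Int.odd_iff]; omega
        simp [hm, h]
      · have hm : Odd m := Int.odd_iff.2 h
        simp [hm, h]
    intro x
    rw [hind, hind]
    omega
  refine bb_moebius_isDegLeFun 3 _ fun I hI => ?_
  -- `4 ∣ Σ_{C_I} u'`
  have hU : (4 : ℤ) ∣ ∑ x ∈ {x : Fin (6 + 6) → Bool | ∀ i, x i = true → i ∈ I}, u' x := by
    have hk : #I ≤ 6 + 6 := (card_le_univ I).trans_eq (Fintype.card_fin _)
    have h8 := TypeOTwelve.cube_sum_dvd g u hg hu I 3 (by omega)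
    have e : ∑ x ∈ {x : Fin (6 + 6) → Bool | ∀ i, x i = true → i ∈ I}, u x =
        2 * ∑ x ∈ {x : Fin (6 + 6) → Bool | ∀ i, x i = true → i ∈ I}, u' x := by rw [mul_sum]
    rw [e] at h8
    norm_num at h8
    omega
  -- `4 ∣ Σ_{C_I} [u' odd]`
  have hL : (4 : ℤ) ∣ ∑ x ∈ {x : Fin (6 + 6) → Bool | ∀ i, x i = true → i ∈ I}, (if decide (Odd (u' x)) = true then 1 else 0 : ℤ) := by
    obtain ⟨z1, hz1⟩ := stub_axParity (6 + 6) 1 (fun x => decide (Odd (u' x))) I le_rfl hℓ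
    have hdig : (∑ x ∈ {x : Fin (6 + 6) → Bool | ∀ i, x i = true → i ∈ I}, sZ (decide (Odd (u' x))) : ℤ) = 2 ^ #I * z1 := by
      have h : ((∑ x ∈ {x : Fin (6 + 6) → Bool | ∀ i, x i = true → i ∈ I}, sZ (decide (Odd (u' x))) : ℤ) : ℝ) =
          (2 : ℝ) ^ ((#I + 1 - 1) / 1) * z1 := by
        push_cast; simp_rw [tp_sZ_cast]; exact hz1
      rw [show (#I + 1 - 1) / 1 = #I by omega] at h
      exact_mod_cast h
    have hsz : ∀ b : Bool, sZ b = 1 - 2 * (if b = true then 1 else 0 : ℤ) := fun b => by cases b <;> simp [sZ]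
    rw [sum_congr rfl fun x _ => hsz (decide (Odd (u' x))), sum_sub_distrib, ← mul_sum, sum_const, nsmul_eq_mul, mul_one,
      bb_card_cube] at hdig
    obtain ⟨k, hk⟩ : ∃ k, #I = k + 3 := ⟨#I - 3, by omega⟩
    rw [hk] at hdig
    have e1 : ((2 ^ (k + 3) : ℕ) : ℤ) = 8 * 2 ^ k := by push_cast; ring
    have e2 : (2 : ℤ) ^ (k + 3) = 8 * 2 ^ k := by ring
    rw [e1, e2] at hdig
    exact ⟨2 ^ k * (1 - z1), by linarith⟩
  have hsum : ∑ x ∈ {x : Fin (6 + 6) → Bool | ∀ i, x i = true → i ∈ I}, u' x =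
      ∑ x ∈ {x : Fin (6 + 6) → Bool | ∀ i, x i = true → i ∈ I}, ((if decide (Odd (u' x)) = true then 1 else 0 : ℤ) +
        2 * (if decide (Odd (u' x / 2)) = true then 1 else 0 : ℤ) + 4 * (u' x / 2 / 2)) := sum_congr rfl fun x _ => hpt x
  rw [sum_add_distrib, sum_add_distrib, ← mul_sum, ← mul_sum] at hsum
  have h2 : (2 : ℤ) ∣ ∑ x ∈ {x : Fin (6 + 6) → Bool | ∀ i, x i = true → i ∈ I}, (if decide (Odd (u' x / 2)) = true then 1 else 0 : ℤ) := by
    obtain ⟨a, ha⟩ := hU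
    obtain ⟨b, hb⟩ := hL
    exact ⟨a - b - ∑ x ∈ {x : Fin (6 + 6) → Bool | ∀ i, x i = true → i ∈ I}, u' x / 2 / 2, by linarith⟩
  rw [sum_boole, filter_filter] at h2
  exact even_iff_two_dvd.2 (Int.natCast_dvd_natCast.1 h2)

/-- Ax on the annihilator of one vector, 12 bits, cubic `D`: `16 ∣ Σ_{x : c·x = 0} (−1)^{D(x)}`. [cite: Carlet2020, §4.1] -/
theorem tw5_ax_ann1 (D : (Fin (6 + 6) → Bool) → Bool) (hD : IsDegLeFun 3 D) (c : Fin (6 + 6) → Bool) :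
    (16 : ℤ) ∣ ∑ x ∈ univ.filter (fun x : Fin (6 + 6) → Bool => twist c x = 1), sZ (D x) := by
  classical
  obtain ⟨z, hz⟩ := fs_ax_annihilator (d := 3) (by norm_num) D hD ![c]
  have e : (univ.filter fun y : Fin (6 + 6) → Bool => ∀ i : Fin 1, twist ((![c] : Fin 1 → Fin (6 + 6) → Bool) i) y = 1) =
      univ.filter fun x : Fin (6 + 6) → Bool => twist c x = 1 := by
    refine filter_congr fun x _ => ?_
    simp
  rw [e] at hz
  have h : ((∑ x ∈ univ.filter (fun x : Fin (6 + 6) → Bool => twist c x = 1), sZ (D x) : ℤ) : ℝ) =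
      (2 : ℝ) ^ ((6 + 6 - 1 + 3 - 1) / 3) * z := by
    push_cast; simp_rw [tp_sZ_cast]; exact hz
  norm_num at h
  exact ⟨z, by exact_mod_cast h⟩

/-- Ax on the annihilator of a vector and a unit vector, 12 bits, cubic `D`: `16 ∣ Σ_{x : c·x = 0, x_j = 0} (−1)^{D(x)}`.
[cite: Carlet2020, §4.1] -/
theorem tw5_ax_ann2 (D : (Fin (6 + 6) → Bool) → Bool) (hD : IsDegLeFun 3 D) (c : Fin (6 + 6) → Bool) (j : Fin (6 + 6)) :
    (16 : ℤ) ∣ ∑ x ∈ univ.filter (fun x : Fin (6 + 6) → Bool => twist c x = 1 ∧ x j = false), sZ (D x) := by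
  classical
  obtain ⟨z, hz⟩ := fs_ax_annihilator (d := 3) (by norm_num) D hD ![c, fun i => decide (i = j)]
  have e : (univ.filter fun y : Fin (6 + 6) → Bool =>
      ∀ i : Fin 2, twist ((![c, fun i => decide (i = j)] : Fin 2 → Fin (6 + 6) → Bool) i) y = 1) =
      univ.filter fun x : Fin (6 + 6) → Bool => twist c x = 1 ∧ x j = false := by
    refine filter_congr fun x _ => ?_
    simp only [Fin.forall_fin_two, Matrix.cons_val_zero, Matrix.cons_val_one]
    rw [tb_twist_single]
    cases x j <;> norm_num [signOf]
  rw [e] at hz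
  have h : ((∑ x ∈ univ.filter (fun x : Fin (6 + 6) → Bool => twist c x = 1 ∧ x j = false), sZ (D x) : ℤ) : ℝ) =
      (2 : ℝ) ^ ((6 + 6 - 2 + 3 - 1) / 3) * z := by
    push_cast; simp_rw [tp_sZ_cast]; exact hz
  norm_num at h
  exact ⟨z, by exact_mod_cast h⟩

/-- Ax on the whole cube and on a coordinate hyperplane, 12 bits, cubic `D`. [cite: Carlet2020, §4.1] -/
theorem tw5_ax_coord (D : (Fin (6 + 6) → Bool) → Bool) (hD : IsDegLeFun 3 D) (j : Fin (6 + 6)) :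
    ((16 : ℤ) ∣ ∑ x, sZ (D x)) ∧ (16 : ℤ) ∣ ∑ x ∈ univ.filter (fun x : Fin (6 + 6) → Bool => x j = false), sZ (D x) := by
  classical
  constructor
  · obtain ⟨z, hz⟩ := stub_axParity (6 + 6) 3 D univ (by norm_num) hD
    rw [filter_true_of_mem (fun (u : Fin (6 + 6) → Bool) (_ : u ∈ univ) i (_ : u i = true) => mem_univ i), card_univ,
      Fintype.card_fin] at hz
    have h : ((∑ x, sZ (D x) : ℤ) : ℝ) = (2 : ℝ) ^ ((6 + 6 + 3 - 1) / 3) * z := by push_cast; simp_rw [tp_sZ_cast]; exact hz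
    norm_num at h
    exact ⟨z, by exact_mod_cast h⟩
  · obtain ⟨z, hz⟩ := fs_ax_annihilator (d := 3) (by norm_num) D hD ![fun i => decide (i = j)]
    have e : (univ.filter fun y : Fin (6 + 6) → Bool =>
        ∀ i : Fin 1, twist ((![fun i => decide (i = j)] : Fin 1 → Fin (6 + 6) → Bool) i) y = 1) =
        univ.filter fun x : Fin (6 + 6) → Bool => x j = false := by
      refine filter_congr fun x _ => ?_
      simp only [Fin.forall_fin_one, Matrix.cons_val_zero]
      rw [tb_twist_single]
      cases x j <;> norm_num [signOf]
    rw [e] at hz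
    have h : ((∑ x ∈ univ.filter (fun x : Fin (6 + 6) → Bool => x j = false), sZ (D x) : ℤ) : ℝ) =
        (2 : ℝ) ^ ((6 + 6 - 1 + 3 - 1) / 3) * z := by
      push_cast; simp_rw [tp_sZ_cast]; exact hz
    norm_num at h
    exact ⟨z, by exact_mod_cast h⟩

/-- **Ax over an affine hyperplane (or its trace on a coordinate hyperplane).**  For affine `ℓ` and cubic `D` on 12 bits:
`16 ∣ Σ_{ℓ = 1} (−1)^D` and `16 ∣ Σ_{ℓ = 1, x_j = 0} (−1)^D` (the set `{ℓ = 1}` is the annihilator of the normal of `ℓ` or its complement).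
[this work] -/
theorem tw5_axP (ℓ D : (Fin (6 + 6) → Bool) → Bool) (hℓ : IsDegLeFun 1 ℓ) (hD : IsDegLeFun 3 D) (j : Fin (6 + 6)) :
    ((16 : ℤ) ∣ ∑ x ∈ univ.filter (fun x : Fin (6 + 6) → Bool => ℓ x = true), sZ (D x)) ∧
    (16 : ℤ) ∣ ∑ x ∈ univ.filter (fun x : Fin (6 + 6) → Bool => ℓ x = true ∧ x j = false), sZ (D x) := by
  classical
  obtain ⟨c, b, hcb⟩ := stub_affineForm (6 + 6) ℓ hℓ
  have htw : ∀ x : Fin (6 + 6) → Bool, twist c x = 1 ∨ twist c x = -1 := fun x => twist_eq_one_or c x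
  cases b
  · -- `ℓ = [twist c = −1]`: the complement of the annihilator
    have hmem : ∀ x, ℓ x = true ↔ ¬ twist c x = 1 := by
      intro x
      have h := hcb x
      simp only [signOf, Bool.false_eq_true, if_false, one_mul] at h
      constructor
      · intro hx; rw [hx] at h; simp at h; linarith
      · intro hx; rcases htw x with h1 | h1
        · exact absurd h1 hx
        · rw [h1] at h; by_contra hne; simp [hne] at h; linarith
    constructor
    · have e : (univ.filter fun x : Fin (6 + 6) → Bool => ℓ x = true) = univ.filter fun x => ¬ twist c x = 1 :=
        filter_congr fun x _ => hmem x
      rw [e]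
      have hsplit := sum_filter_add_sum_filter_not univ (fun x : Fin (6 + 6) → Bool => twist c x = 1) (fun x => sZ (D x))
      have h1 := (tw5_ax_coord D hD j).1
      have h2 := tw5_ax_ann1 D hD c
      have e2 : ∑ x ∈ univ.filter (fun x : Fin (6 + 6) → Bool => ¬ twist c x = 1), sZ (D x) =
          ∑ x, sZ (D x) - ∑ x ∈ univ.filter (fun x : Fin (6 + 6) → Bool => twist c x = 1), sZ (D x) := by linarith
      rw [e2]; exact dvd_sub h1 h2
    · have e : (univ.filter fun x : Fin (6 + 6) → Bool => ℓ x = true ∧ x j = false) =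
          (univ.filter fun x : Fin (6 + 6) → Bool => x j = false).filter fun x => ¬ twist c x = 1 := by
        rw [filter_filter]; exact filter_congr fun x _ => by rw [hmem x]; tauto
      rw [e]
      have hsplit := sum_filter_add_sum_filter_not (univ.filter fun x : Fin (6 + 6) → Bool => x j = false)
        (fun x : Fin (6 + 6) → Bool => twist c x = 1) (fun x => sZ (D x))
      have h1 := (tw5_ax_coord D hD j).2
      have h2 := tw5_ax_ann2 D hD c j
      rw [filter_filter] at hsplit
      have e3 : (univ.filter fun x : Fin (6 + 6) → Bool => x j = false ∧ twist c x = 1) =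
          univ.filter fun x : Fin (6 + 6) → Bool => twist c x = 1 ∧ x j = false := filter_congr fun x _ => by tauto
      rw [e3] at hsplit
      have e2 : ∑ x ∈ (univ.filter fun x : Fin (6 + 6) → Bool => x j = false).filter (fun x => ¬ twist c x = 1), sZ (D x) =
          ∑ x ∈ univ.filter (fun x : Fin (6 + 6) → Bool => x j = false), sZ (D x) -
          ∑ x ∈ univ.filter (fun x : Fin (6 + 6) → Bool => twist c x = 1 ∧ x j = false), sZ (D x) := by linarith
      rw [e2]; exact dvd_sub h1 h2
  · -- `ℓ = [twist c = 1]`: the annihilator itself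
    have hmem : ∀ x, ℓ x = true ↔ twist c x = 1 := by
      intro x
      have h := hcb x
      simp only [signOf, if_true] at h
      constructor
      · intro hx; rw [hx] at h; simp at h; linarith
      · intro hx; rw [hx] at h; by_contra hne; simp [hne] at h; linarith
    constructor
    · have e : (univ.filter fun x : Fin (6 + 6) → Bool => ℓ x = true) = univ.filter fun x => twist c x = 1 :=
        filter_congr fun x _ => hmem x
      rw [e]; exact tw5_ax_ann1 D hD c
    · have e : (univ.filter fun x : Fin (6 + 6) → Bool => ℓ x = true ∧ x j = false) =
          univ.filter fun x => twist c x = 1 ∧ x j = false := filter_congr fun x _ => by rw [hmem x]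
      rw [e]; exact tw5_ax_ann2 D hD c j

/-- **Walsh inversion at `0` and at a unit vector, integer form.**  With `W_g = 32u'`: `Σ_x u'(x) = 128(−1)^{g(0)}` and
`Σ_x u'(x)(−1)^{x_j} = 128(−1)^{g(e_j)}`. [folklore] -/
theorem tw5_inversion (g : (Fin (6 + 6) → Bool) → Bool) (u' : (Fin (6 + 6) → Bool) → ℤ)
    (hu' : ∀ x, W (fun y => signOf (g y)) x = (2 : ℝ) ^ 5 * (u' x : ℝ)) (j : Fin (6 + 6)) :
    (∑ x, u' x = 128 * sZ (g zeroVec)) ∧ ∑ x, u' x * sZ (x j) = 128 * sZ (g (fun i => decide (i = j))) := by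
  constructor
  · have h := tz_inversion (fun y => signOf (g y)) zeroVec
    have e : ∀ x : Fin (6 + 6) → Bool, W (fun y => signOf (g y)) x * twist x zeroVec = (2 : ℝ) ^ 5 * (u' x : ℝ) := fun x => by
      rw [twist_zeroVec_right, mul_one, hu' x]
    rw [sum_congr rfl fun x _ => e x, ← mul_sum] at h
    have h2 : ∑ x, (u' x : ℝ) = 2 ^ 7 * signOf (g zeroVec) := by
      have e12 : (2 : ℝ) ^ (6 + 6) = 2 ^ 5 * 2 ^ 7 := by norm_num
      rw [e12, mul_assoc] at h
      exact mul_left_cancel₀ (by positivity) h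
    have h' : ((∑ x, u' x : ℤ) : ℝ) = ((128 * sZ (g zeroVec) : ℤ) : ℝ) := by push_cast; rw [tp_sZ_cast, h2]; ring
    exact_mod_cast h'
  · have h := tz_inversion (fun y => signOf (g y)) (fun i => decide (i = j))
    have e : ∀ x : Fin (6 + 6) → Bool, W (fun y => signOf (g y)) x * twist x (fun i => decide (i = j)) =
        (2 : ℝ) ^ 5 * ((u' x : ℝ) * signOf (x j)) := fun x => by
      rw [twist_comm, tb_twist_single, hu' x]; ring
    rw [sum_congr rfl fun x _ => e x, ← mul_sum] at h
    have h2 : ∑ x, (u' x : ℝ) * signOf (x j) = 2 ^ 7 * signOf (g (fun i => decide (i = j))) := by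
      have e12 : (2 : ℝ) ^ (6 + 6) = 2 ^ 5 * 2 ^ 7 := by norm_num
      rw [e12, mul_assoc] at h
      exact mul_left_cancel₀ (by positivity) h
    have h' : ((∑ x, u' x * sZ (x j) : ℤ) : ℝ) = ((128 * sZ (g (fun i => decide (i = j))) : ℤ) : ℝ) := by
      push_cast; simp_rw [tp_sZ_cast]; rw [h2]; ring
    exact_mod_cast h'

end LevelFiveTools

end Summit.QuantumAdvantage.QuantumAdvantage.Theorems.CubicForrelation.NearExactIsExact

end
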